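import Literature.Analysis.PDE.MaxRegEstimate
import HarnessLib

/-!
# The linear a priori estimate with constants uniform in sub-intervals (topic `Analysis/PDE`)

A variant of `LinApriori.lean` / `MaxRegEstimate.lean` needed by the quasilinear Picard scheme
(hypothesis `hQL` of `Literature.Geometry.Riemannian.ricciFlow_shortTime_existence_of_quasilinear`):
the constants `Λ, C` of the weighted a priori estimate are produced from the coefficient data on
`[0, T]` and then serve every solution on every sub-slab `[0, T']`, `T' ≤ T`. This removes the
formal dependence of the constants on the length of the interval, so that the existence time of
the nonlinear problem can be chosen after the constants.

* `PatchSystemLoc.sobolevEnergy_slabResidual_le_unif`, `PatchSystemLoc.linear_apriori_residual_le_unif`,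
  `PatchSystemLoc.maxreg_apriori_le_unif`.

Everything is proved; no named fact and no `sorry` is introduced.

## References

* L. C. Evans, *Partial Differential Equations*, 2nd ed., AMS 2010, §7.1.3. [Evans2010]
-/

noncomputable section

open Set Function Filter Topology Metric MeasureTheory InnerProductSpace
open scoped Manifold ContDiff Topology ENNReal RealInnerProductSpace Laplacian

namespace Literature.Analysis.PDE

open Literature.Geometry.Manifold Literature.Analysis.FunctionSpaces Literature.Analysis.FluidPDE

variable {E : Type*} [NormedAddCommGroup E] [NormedSpace ℝ E] {H : Type*} [TopologicalSpace H]
variable {I : ModelWithCorners ℝ E H} {M : Type*} [TopologicalSpace M] [ChartedSpace H M]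
variable {E' : Type*} [NormedAddCommGroup E'] [InnerProductSpace ℝ E'] [FiniteDimensional ℝ E']
variable {F' : Type*} [NormedAddCommGroup F'] [InnerProductSpace ℝ F']
variable {ι : Type*} [Fintype ι] (P : PatchSystem I M E' ι)

namespace PatchSystemLoc

/-! ### Slab smoothness of cut-off products -/

section PerTime

variable [IsManifold I ∞ M] [I.Boundaryless] [T2Space M] [MeasurableSpace E'] [BorelSpace E'] {T : ℝ}

/-- **Per-time energy inequality for the residual of a patch, uniform in sub-slabs** (coefficient
fields fixed on `[0, T]`, `ε = 1`): there are finite `A₂, A₃, A₄` such that for every `T' ≤ T`, every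
`v`, `g` with slab-smooth chart expressions on `[0, T']` satisfying the chart form of the system in
the patch `p`, and every `s ∈ [0, T']`,
`E_i(∂ₜw_p - Δw_p) ≤ 4n²η² Σₖₗ E_i(∂ₖ∂ₗw_p) + A₂ Σₗ E_i(∂ₗw_p)
  + A₃ Σ_q (E_i(w_q) + Σ_m E_i(∂_m w_q)) + A₄ E_i(cutExpr P p (g s))` (all at time `s`).
[cite: Evans2010, §7.1.3] -/
theorem sobolevEnergy_slabResidual_le_unif (hT : 0 < T) (p : ι) (i : ℕ) {S : ℝ → E' → (E' →L[ℝ] E')}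
    {𝔟 : ℝ → E' → ((E' →L[ℝ] F') →L[ℝ] F')} {𝔠 : ℝ → E' → (F' →L[ℝ] F')}
    (hS : ContDiffOn ℝ ∞ (uncurry S) (Icc 0 T ×ˢ (P.chart p).target))
    (h𝔟 : ContDiffOn ℝ ∞ (uncurry 𝔟) (Icc 0 T ×ˢ (P.chart p).target))
    (h𝔠 : ContDiffOn ℝ ∞ (uncurry 𝔠) (Icc 0 T ×ˢ (P.chart p).target)) {η : ℝ} (hη : 0 ≤ η)
    (hηS : ∀ s ∈ Icc 0 T, ∀ y ∈ closedBall (0 : E') (4 * P.r p), ‖S s y - 1‖ ≤ η) :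
    ∃ A₂ A₃ A₄ : ℝ≥0∞, A₂ ≠ ⊤ ∧ A₃ ≠ ⊤ ∧ A₄ ≠ ⊤ ∧ ∀ {T' : ℝ}, 0 < T' → T' ≤ T → ∀ {v g : ℝ → M → F'},
      (∀ q, ContDiffOn ℝ ∞ (uncurry fun s y ↦ v s ((P.chart q).inv y)) (Icc 0 T' ×ˢ (P.chart q).target)) →
      ContDiffOn ℝ ∞ (uncurry fun s y ↦ g s ((P.chart p).inv y)) (Icc 0 T' ×ˢ (P.chart p).target) →
      (∀ s ∈ Icc 0 T', ∀ y ∈ (P.chart p).target,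
        timeDerivWithin (Icc 0 T') (fun s y ↦ v s ((P.chart p).inv y)) s y =
          frameOp (S s y) (𝔟 s y) (𝔠 s y) (fun y ↦ v s ((P.chart p).inv y)) y + g s ((P.chart p).inv y)) →
      ∀ s ∈ Icc 0 T',
        sobolevEnergy i (slabResidual 1 T' (fun s ↦ cutExpr P p (v s)) s) ≤
          ENNReal.ofReal (4 * (Module.finrank ℝ E' : ℝ) ^ 2 * η ^ 2) * ∑ k, ∑ l,
              sobolevEnergy i (fun y ↦ fderiv ℝ (fun z ↦ fderiv ℝ (cutExpr P p (v s)) z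
                (stdOrthonormalBasis ℝ E' l)) y (stdOrthonormalBasis ℝ E' k)) +
          A₂ * ∑ l, sobolevEnergy i (fun y ↦ fderiv ℝ (cutExpr P p (v s)) y (stdOrthonormalBasis ℝ E' l)) +
          A₃ * ∑ q, (sobolevEnergy i (cutExpr P q (v s)) +
            ∑ m, sobolevEnergy i (fun y ↦ fderiv ℝ (cutExpr P q (v s)) y (stdOrthonormalBasis ℝ E' m))) +
          A₄ * sobolevEnergy i (cutExpr P p (g s)) := by
  classical
  obtain ⟨Csh, Clow, Cg, hCshtop, hClowtop, hCgtop, hres⟩ :=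
    sobolevEnergy_residual_le (F' := F') P p i one_pos le_rfl
  obtain ⟨Mc, hMc0, hMc⟩ := exists_coeff_bound (F' := F') P hT p i hS h𝔟 h𝔠
  set N2 : ℝ≥0∞ := ((Module.finrank ℝ E' * Module.finrank ℝ E' : ℕ) : ℝ≥0∞) with hN2
  refine ⟨2 * N2 * (Module.finrank ℝ E' : ℝ≥0∞) * Csh * ENNReal.ofReal (Mc ^ 2),
    2 * Clow * ENNReal.ofReal (Mc ^ 2 + 1), 2 * Cg, ?_, ?_, ?_, ?_⟩
  · exact ENNReal.mul_ne_top (ENNReal.mul_ne_top (ENNReal.mul_ne_top (ENNReal.mul_ne_top (by norm_num)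
      (ENNReal.natCast_ne_top _)) (ENNReal.natCast_ne_top _)) hCshtop) ENNReal.ofReal_ne_top
  · exact ENNReal.mul_ne_top (ENNReal.mul_ne_top (by norm_num) hClowtop) ENNReal.ofReal_ne_top
  · exact ENNReal.mul_ne_top (by norm_num) hCgtop
  intro T' hT' hT'T v g hv hg hpde s hs
  have hsT : s ∈ Icc 0 T := ⟨hs.1, hs.2.trans hT'T⟩
  -- the slice data
  have hslice : ∀ {G : ℝ → E' → F'} {V : Set E'}, ContDiffOn ℝ ∞ (uncurry G) (Icc 0 T' ×ˢ V) →
      ContDiffOn ℝ ∞ (G s) V := fun {G V} hG ↦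
    hG.comp (contDiff_const.prodMk contDiff_id).contDiffOn fun y hy ↦ mk_mem_prod hs hy
  have hf : ∀ q, ContDiffOn ℝ ∞ (v s ∘ (P.chart q).inv) (P.chart q).target := fun q ↦ hslice (hv q)
  have hg' : ContDiffOn ℝ ∞ (g s ∘ (P.chart p).inv) (P.chart p).target := hslice hg
  have hcu := contDiff_timeDerivWithin_cutExpr P hT' p (hv p) hs
  have ha : ∀ k l, ContDiff ℝ ∞ (topCoeff P p (S s) k l) := fun k l ↦
    (isSmoothSpaceTimeOn_topCoeff P p hS k l).contDiff_slice hsT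
  have hBf : ∀ l, ContDiff ℝ ∞ (firstCoeff P p (𝔟 s) l) := fun l ↦
    (isSmoothSpaceTimeOn_firstCoeff P p h𝔟 l).contDiff_slice hsT
  have hCf : ContDiff ℝ ∞ (zeroCoeff P p (𝔠 s)) := (isSmoothSpaceTimeOn_zeroCoeff P p h𝔠).contDiff_slice hsT
  have haη : ∀ k l y, |topCoeff P p (S s) k l y| ≤ η := abs_topCoeff_le P p hη (hηS s hsT)
  obtain ⟨ha0, haw, hB0, hBw, hC0, hCw⟩ := hMc s hsT
  have h := hres hf hg' hcu (fun y hy ↦ hpde s hs y hy) ha hBf hCf haη ha0 haw hB0 hBw hC0 hCw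
  rw [slabResidual_cutExpr_eq P p (hv p) hs]
  refine h.trans (le_of_eq ?_)
  -- arithmetic with `ε = 1`
  have h2 : ENNReal.ofReal (1 + 1) = 2 := by norm_num
  have h2' : ENNReal.ofReal (1 + 1⁻¹) = 2 := by norm_num
  rw [h2, h2']
  have key : ∀ (A B : ℝ≥0∞) (a : Fin (Module.finrank ℝ E') → Fin (Module.finrank ℝ E') → ℝ≥0∞)
      (c : Fin (Module.finrank ℝ E') → ℝ≥0∞),
      ∑ k, ∑ l, (A * a k l + B * c l) = A * ∑ k, ∑ l, a k l + (Module.finrank ℝ E' : ℝ≥0∞) * B * ∑ l, c l := by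
    intro A B a c
    simp only [Finset.sum_add_distrib, Finset.mul_sum]
    congr 1
    simp only [Finset.sum_const, Finset.card_univ, Fintype.card_fin, nsmul_eq_mul]
    rw [Finset.mul_sum]
    refine Finset.sum_congr rfl fun l _ ↦ ?_
    ring
  rw [key]
  have hη2 : ENNReal.ofReal (4 * (Module.finrank ℝ E' : ℝ) ^ 2 * η ^ 2) =
      2 * N2 * (2 * ENNReal.ofReal (η ^ 2)) := by
    rw [hN2, show (4 * (Module.finrank ℝ E' : ℝ) ^ 2 * η ^ 2) = (2 * ((Module.finrank ℝ E' *
      Module.finrank ℝ E' : ℕ) : ℝ)) * (2 * η ^ 2) by push_cast; ring]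
    rw [ENNReal.ofReal_mul (by positivity), ENNReal.ofReal_mul (by norm_num),
      ENNReal.ofReal_mul (by norm_num), ENNReal.ofReal_natCast]
    norm_num
  rw [hη2]
  ring

end PerTime

section Main

variable [IsManifold I ∞ M] [I.Boundaryless] [T2Space M] [MeasurableSpace E'] [BorelSpace E']
  [FiniteDimensional ℝ F'] {T : ℝ}

/-- **The linear a priori estimate on a closed manifold (residual form), with constants serving every
sub-slab `[0, T']`, `T' ≤ T`.** Given a patch system,
slab-smooth coefficient fields with symbol within `η` of the identity on each patch,
`16 n³ η² ≤ 1`, and an order `i`, there are `Λ > 0` and `C < ∞` such that for every `λ ≥ Λ`,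
every `v` (with `v(0) = 0`) and `g` with slab-smooth chart expressions satisfying the chart form
of the linear system `∂ₜv̂_p = frameOp (S p) (𝔟 p) (𝔠 p) v̂_p + ĝ_p` on every patch, and every
`t ∈ [0, T]`:
`Σ_p ∫₀ᵗ e^{-2λs} E_i(∂ₜw_p - Δw_p) ≤ C Σ_p ∫₀ᵗ e^{-2λs} E_i(cutExpr P p (g s))`,
`w_p = cutExpr P p (v ·)`. [cite: Evans2010, §7.1.3] -/
theorem linear_apriori_residual_le_unif (hT : 0 < T) (i : ℕ) {S : ι → ℝ → E' → (E' →L[ℝ] E')}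
    {𝔟 : ι → ℝ → E' → ((E' →L[ℝ] F') →L[ℝ] F')} {𝔠 : ι → ℝ → E' → (F' →L[ℝ] F')}
    (hS : ∀ p, ContDiffOn ℝ ∞ (uncurry (S p)) (Icc 0 T ×ˢ (P.chart p).target))
    (h𝔟 : ∀ p, ContDiffOn ℝ ∞ (uncurry (𝔟 p)) (Icc 0 T ×ˢ (P.chart p).target))
    (h𝔠 : ∀ p, ContDiffOn ℝ ∞ (uncurry (𝔠 p)) (Icc 0 T ×ˢ (P.chart p).target)) {η : ℝ} (hη : 0 ≤ η)
    (hηS : ∀ p, ∀ s ∈ Icc 0 T, ∀ y ∈ closedBall (0 : E') (4 * P.r p), ‖S p s y - 1‖ ≤ η)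
    (hsmall : 16 * (Module.finrank ℝ E' : ℝ) ^ 3 * η ^ 2 ≤ 1) :
    ∃ Λ : ℝ, 0 < Λ ∧ ∃ C : ℝ≥0∞, C ≠ ⊤ ∧ ∀ {lam : ℝ}, Λ ≤ lam → ∀ {T' : ℝ}, 0 < T' → T' ≤ T → ∀ {v g : ℝ → M → F'},
      (∀ p, ContDiffOn ℝ ∞ (uncurry fun s y ↦ v s ((P.chart p).inv y)) (Icc 0 T' ×ˢ (P.chart p).target)) →
      (∀ x, v 0 x = 0) →
      (∀ p, ContDiffOn ℝ ∞ (uncurry fun s y ↦ g s ((P.chart p).inv y)) (Icc 0 T' ×ˢ (P.chart p).target)) →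
      (∀ p, ∀ s ∈ Icc 0 T', ∀ y ∈ (P.chart p).target,
        timeDerivWithin (Icc 0 T') (fun s y ↦ v s ((P.chart p).inv y)) s y =
          frameOp (S p s y) (𝔟 p s y) (𝔠 p s y) (fun y ↦ v s ((P.chart p).inv y)) y +
            g s ((P.chart p).inv y)) →
      ∀ t ∈ Icc 0 T',
        ∑ p, ∫⁻ s in Ioo 0 t, ENNReal.ofReal (Real.exp (-2 * lam * s)) *
            sobolevEnergy i (slabResidual 1 T' (fun s ↦ cutExpr P p (v s)) s) ≤
          C * ∑ p, ∫⁻ s in Ioo 0 t, ENNReal.ofReal (Real.exp (-2 * lam * s)) *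
            sobolevEnergy i (cutExpr P p (g s)) := by
  classical
  -- per-patch constants of the per-time inequality
  have hp : ∀ p, ∃ A₂ A₃ A₄ : ℝ≥0∞, A₂ ≠ ⊤ ∧ A₃ ≠ ⊤ ∧ A₄ ≠ ⊤ ∧ ∀ {T' : ℝ}, 0 < T' → T' ≤ T → ∀ {v g : ℝ → M → F'},
      (∀ q, ContDiffOn ℝ ∞ (uncurry fun s y ↦ v s ((P.chart q).inv y)) (Icc 0 T' ×ˢ (P.chart q).target)) →
      ContDiffOn ℝ ∞ (uncurry fun s y ↦ g s ((P.chart p).inv y)) (Icc 0 T' ×ˢ (P.chart p).target) →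
      (∀ s ∈ Icc 0 T', ∀ y ∈ (P.chart p).target,
        timeDerivWithin (Icc 0 T') (fun s y ↦ v s ((P.chart p).inv y)) s y =
          frameOp (S p s y) (𝔟 p s y) (𝔠 p s y) (fun y ↦ v s ((P.chart p).inv y)) y + g s ((P.chart p).inv y)) →
      ∀ s ∈ Icc 0 T',
        sobolevEnergy i (slabResidual 1 T' (fun s ↦ cutExpr P p (v s)) s) ≤
          ENNReal.ofReal (4 * (Module.finrank ℝ E' : ℝ) ^ 2 * η ^ 2) * ∑ k, ∑ l,
              sobolevEnergy i (fun y ↦ fderiv ℝ (fun z ↦ fderiv ℝ (cutExpr P p (v s)) z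
                (stdOrthonormalBasis ℝ E' l)) y (stdOrthonormalBasis ℝ E' k)) +
          A₂ * ∑ l, sobolevEnergy i (fun y ↦ fderiv ℝ (cutExpr P p (v s)) y (stdOrthonormalBasis ℝ E' l)) +
          A₃ * ∑ q, (sobolevEnergy i (cutExpr P q (v s)) +
            ∑ m, sobolevEnergy i (fun y ↦ fderiv ℝ (cutExpr P q (v s)) y (stdOrthonormalBasis ℝ E' m))) +
          A₄ * sobolevEnergy i (cutExpr P p (g s)) := fun p ↦
    sobolevEnergy_slabResidual_le_unif P hT p i (hS p) (h𝔟 p) (h𝔠 p) hη (hηS p)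
  choose A₂ A₃ A₄ hA₂ hA₃ hA₄ hineq using hp
  set a₂ : ℝ≥0∞ := ∑ p, A₂ p with ha₂
  set a₃ : ℝ≥0∞ := ∑ p, A₃ p with ha₃
  set a₄ : ℝ≥0∞ := ∑ p, A₄ p with ha₄
  have ha₂top : a₂ ≠ ⊤ := ENNReal.sum_ne_top.2 fun p _ ↦ hA₂ p
  have ha₃top : a₃ ≠ ⊤ := ENNReal.sum_ne_top.2 fun p _ ↦ hA₃ p
  have ha₄top : a₄ ≠ ⊤ := ENNReal.sum_ne_top.2 fun p _ ↦ hA₄ p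
  have hA₂le : ∀ p, A₂ p ≤ a₂ := fun p ↦ Finset.single_le_sum (f := A₂) (fun _ _ ↦ bot_le) (Finset.mem_univ p)
  have hA₄le : ∀ p, A₄ p ≤ a₄ := fun p ↦ Finset.single_le_sum (f := A₄) (fun _ _ ↦ bot_le) (Finset.mem_univ p)
  -- the threshold `Λ`
  set Kc : ℝ≥0∞ := a₂ + 2 * a₃ with hKc
  have hKctop : Kc ≠ ⊤ := ENNReal.add_ne_top.2 ⟨ha₂top, ENNReal.mul_ne_top (by norm_num) ha₃top⟩
  refine ⟨max 1 (4 * Kc.toReal), lt_max_of_lt_left one_pos, 2 * a₄, ENNReal.mul_ne_top (by norm_num) ha₄top, ?_⟩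
  intro lam hlam T' hT' hT'T v g hv hv0 hg hpde t ht
  have hlam1 : 1 ≤ lam := (le_max_left _ _).trans hlam
  have hlam0 : 0 < lam := one_pos.trans_le hlam1
  have hlamK : 4 * Kc.toReal ≤ lam := (le_max_right _ _).trans hlam
  -- notation for the weighted integrals
  set W : ℝ → ℝ≥0∞ := fun s ↦ ENNReal.ofReal (Real.exp (-2 * lam * s)) with hW
  have hWm : Measurable W := (Real.continuous_exp.comp (continuous_const.mul continuous_id)).measurable.ennreal_ofReal
  set w : ι → ℝ → E' → F' := fun p s ↦ cutExpr P p (v s) with hw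
  -- the families `w p` satisfy the hypotheses of the engine
  have hws : ∀ p, IsSmoothSpaceTimeOn (Icc 0 T') (w p) := fun p ↦ isSmoothSpaceTimeOn_cutExpr P p (hv p)
  have hKp : ∀ p, IsCompact (closedBall (0 : E') (3 * P.r p)) := fun p ↦ isCompact_closedBall _ _
  have hwK : ∀ p s, ∀ y ∉ closedBall (0 : E') (3 * P.r p), w p s y = 0 := fun p s y hy ↦
    cutExpr_family_eq_zero P p s hy
  have hw0 : ∀ p y, w p 0 y = 0 := fun p y ↦ cutExpr_family_zero P p hv0 y
  -- the quantities
  set R : ι → ℝ≥0∞ := fun p ↦ ∫⁻ s in Ioo 0 t, W s * sobolevEnergy i (slabResidual 1 T' (w p) s) with hR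
  set X : ι → ℝ≥0∞ := fun p ↦ ∫⁻ s in Ioo 0 t, W s * ∑ k, ∑ l, sobolevEnergy i
    (fun y ↦ fderiv ℝ (fun z ↦ fderiv ℝ (w p s) z (stdOrthonormalBasis ℝ E' l)) y (stdOrthonormalBasis ℝ E' k))
    with hX
  set Y : ι → ℝ≥0∞ := fun p ↦ ∫⁻ s in Ioo 0 t, W s * ∑ l, sobolevEnergy i
    (fun y ↦ fderiv ℝ (w p s) y (stdOrthonormalBasis ℝ E' l)) with hY
  set Z : ι → ℝ≥0∞ := fun p ↦ ∫⁻ s in Ioo 0 t, W s * sobolevEnergy i (w p s) with hZ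
  set G : ι → ℝ≥0∞ := fun p ↦ ∫⁻ s in Ioo 0 t, W s * sobolevEnergy i (cutExpr P p (g s)) with hG
  -- the engine bounds
  have hXle : ∀ p, X p ≤ (Module.finrank ℝ E' : ℝ≥0∞) * R p := by
    intro p
    have h := lintegral_weight_sum_sobolevEnergy_fderiv_fderiv_le_residual hT' one_pos (hws p) (hKp p) (hwK p)
      (hw0 p) hlam0.le i ht
    have h1 : ENNReal.ofReal ((Module.finrank ℝ E' : ℝ) / 1 ^ 2) = (Module.finrank ℝ E' : ℝ≥0∞) := by
      rw [one_pow, div_one, ENNReal.ofReal_natCast]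
    rw [h1] at h
    refine le_trans (le_of_eq ?_) h
    rw [hX]
    simp only
    refine lintegral_congr fun s ↦ ?_
    rw [Finset.sum_comm]
  have hYle : ∀ p, Y p ≤ ENNReal.ofReal (lam⁻¹ / 2) * R p := by
    intro p
    have h := lintegral_weight_sum_sobolevEnergy_fderiv_le_residual hT' one_pos (hws p) (hKp p) (hwK p)
      (hw0 p) hlam0 i ht
    rwa [mul_one] at h
  have hZle : ∀ p, Z p ≤ ENNReal.ofReal (lam⁻¹ ^ 2) * R p := fun p ↦
    lintegral_weight_sobolevEnergy_le_residual hT' one_pos (hws p) (hKp p) (hwK p) (hw0 p) hlam0 i ht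
  have hRtop : ∀ p, R p ≠ ⊤ := fun p ↦
    lintegral_weight_sobolevEnergy_slab_ne_top hT' (isSmoothSpaceTimeOn_slabResidual hT' (hws p)) (hKp p)
      (fun s y hy ↦ slabResidual_eq_zero (hKp p).isClosed (hwK p) s hy) i hlam0.le ht.2
  -- measurability of the slice energies on `(0, t)`
  have hd1 : ∀ p l, IsSmoothSpaceTimeOn (Icc 0 T') fun s y ↦ fderiv ℝ (w p s) y (stdOrthonormalBasis ℝ E' l) :=
    fun p l ↦ isSmoothSpaceTimeOn_fderiv_apply_Icc hT' (hws p) _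
  have hd2 : ∀ p k l, IsSmoothSpaceTimeOn (Icc 0 T') fun s y ↦
      fderiv ℝ (fun z ↦ fderiv ℝ (w p s) z (stdOrthonormalBasis ℝ E' l)) y (stdOrthonormalBasis ℝ E' k) :=
    fun p k l ↦ isSmoothSpaceTimeOn_fderiv_apply_Icc hT' (hd1 p l) _
  have mX : ∀ p, AEMeasurable (fun s ↦ ∑ k, ∑ l, sobolevEnergy i (fun y ↦ fderiv ℝ
      (fun z ↦ fderiv ℝ (w p s) z (stdOrthonormalBasis ℝ E' l)) y (stdOrthonormalBasis ℝ E' k)))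
      (volume.restrict (Ioo 0 t)) := fun p ↦
    Finset.aemeasurable_fun_sum _ fun k _ ↦ Finset.aemeasurable_fun_sum _ fun l _ ↦
      aemeasurable_sobolevEnergy_slice isOpen_Ioo i ((hd2 p k l).mono fun _ hs ↦ ⟨hs.1.le, hs.2.le.trans ht.2⟩)
  have mY : ∀ p, AEMeasurable (fun s ↦ ∑ l, sobolevEnergy i (fun y ↦ fderiv ℝ (w p s) y
      (stdOrthonormalBasis ℝ E' l))) (volume.restrict (Ioo 0 t)) := fun p ↦
    Finset.aemeasurable_fun_sum _ fun l _ ↦ aemeasurable_sobolevEnergy_slice isOpen_Ioo i ((hd1 p l).mono fun _ hs ↦ ⟨hs.1.le, hs.2.le.trans ht.2⟩)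
  have mZ : ∀ p, AEMeasurable (fun s ↦ sobolevEnergy i (w p s)) (volume.restrict (Ioo 0 t)) := fun p ↦
    aemeasurable_sobolevEnergy_slice isOpen_Ioo i ((hws p).mono fun _ hs ↦ ⟨hs.1.le, hs.2.le.trans ht.2⟩)
  have mG : ∀ p, AEMeasurable (fun s ↦ sobolevEnergy i (cutExpr P p (g s))) (volume.restrict (Ioo 0 t)) :=
    fun p ↦ aemeasurable_sobolevEnergy_slice isOpen_Ioo i ((isSmoothSpaceTimeOn_cutExpr P p (hg p)).mono fun _ hs ↦ ⟨hs.1.le, hs.2.le.trans ht.2⟩)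
  have hWm' : AEMeasurable W (volume.restrict (Ioo 0 t)) := hWm.aemeasurable
  -- Step 1: integrate the per-time inequality
  set c₁ : ℝ≥0∞ := ENNReal.ofReal (4 * (Module.finrank ℝ E' : ℝ) ^ 2 * η ^ 2) with hc₁
  have hRle : ∀ p, R p ≤ c₁ * X p + A₂ p * Y p + A₃ p * ∑ q, (Z q + Y q) + A₄ p * G p := by
    intro p
    have hpt : ∀ s ∈ Ioo 0 t, W s * sobolevEnergy i (slabResidual 1 T' (w p) s) ≤
        W s * (c₁ * ∑ k, ∑ l, sobolevEnergy i (fun y ↦ fderiv ℝ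
          (fun z ↦ fderiv ℝ (w p s) z (stdOrthonormalBasis ℝ E' l)) y (stdOrthonormalBasis ℝ E' k))) +
        W s * (A₂ p * ∑ l, sobolevEnergy i (fun y ↦ fderiv ℝ (w p s) y (stdOrthonormalBasis ℝ E' l))) +
        W s * (A₃ p * ∑ q, (sobolevEnergy i (w q s) +
          ∑ m, sobolevEnergy i (fun y ↦ fderiv ℝ (w q s) y (stdOrthonormalBasis ℝ E' m)))) +
        W s * (A₄ p * sobolevEnergy i (cutExpr P p (g s))) := by
      intro s hs
      have hs' : s ∈ Icc 0 T' := ⟨hs.1.le, hs.2.le.trans ht.2⟩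
      have h := hineq p hT' hT'T hv (hg p) (hpde p) s hs'
      calc W s * sobolevEnergy i (slabResidual 1 T' (w p) s)
          ≤ W s * (c₁ * ∑ k, ∑ l, sobolevEnergy i (fun y ↦ fderiv ℝ
              (fun z ↦ fderiv ℝ (w p s) z (stdOrthonormalBasis ℝ E' l)) y (stdOrthonormalBasis ℝ E' k)) +
            A₂ p * ∑ l, sobolevEnergy i (fun y ↦ fderiv ℝ (w p s) y (stdOrthonormalBasis ℝ E' l)) +
            A₃ p * ∑ q, (sobolevEnergy i (w q s) +
              ∑ m, sobolevEnergy i (fun y ↦ fderiv ℝ (w q s) y (stdOrthonormalBasis ℝ E' m))) +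
            A₄ p * sobolevEnergy i (cutExpr P p (g s))) := mul_le_mul' le_rfl h
        _ = _ := by ring
    calc R p ≤ ∫⁻ s in Ioo 0 t, (W s * (c₁ * ∑ k, ∑ l, sobolevEnergy i (fun y ↦ fderiv ℝ
          (fun z ↦ fderiv ℝ (w p s) z (stdOrthonormalBasis ℝ E' l)) y (stdOrthonormalBasis ℝ E' k))) +
        W s * (A₂ p * ∑ l, sobolevEnergy i (fun y ↦ fderiv ℝ (w p s) y (stdOrthonormalBasis ℝ E' l))) +
        W s * (A₃ p * ∑ q, (sobolevEnergy i (w q s) +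
          ∑ m, sobolevEnergy i (fun y ↦ fderiv ℝ (w q s) y (stdOrthonormalBasis ℝ E' m)))) +
        W s * (A₄ p * sobolevEnergy i (cutExpr P p (g s)))) := setLIntegral_mono' measurableSet_Ioo hpt
      _ = c₁ * X p + A₂ p * Y p + A₃ p * ∑ q, (Z q + Y q) + A₄ p * G p := by
        have m1 : AEMeasurable (fun s ↦ W s * (c₁ * ∑ k, ∑ l, sobolevEnergy i (fun y ↦ fderiv ℝ
            (fun z ↦ fderiv ℝ (w p s) z (stdOrthonormalBasis ℝ E' l)) y (stdOrthonormalBasis ℝ E' k))))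
            (volume.restrict (Ioo 0 t)) := hWm'.mul ((mX p).const_mul _)
        have m2 : AEMeasurable (fun s ↦ W s * (A₂ p * ∑ l, sobolevEnergy i (fun y ↦ fderiv ℝ (w p s) y
            (stdOrthonormalBasis ℝ E' l)))) (volume.restrict (Ioo 0 t)) := hWm'.mul ((mY p).const_mul _)
        have mq : AEMeasurable (fun s ↦ ∑ q, (sobolevEnergy i (w q s) +
            ∑ m, sobolevEnergy i (fun y ↦ fderiv ℝ (w q s) y (stdOrthonormalBasis ℝ E' m))))
            (volume.restrict (Ioo 0 t)) :=
          Finset.aemeasurable_fun_sum _ fun q _ ↦ (mZ q).add (mY q)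
        have m3 : AEMeasurable (fun s ↦ W s * (A₃ p * ∑ q, (sobolevEnergy i (w q s) +
            ∑ m, sobolevEnergy i (fun y ↦ fderiv ℝ (w q s) y (stdOrthonormalBasis ℝ E' m)))))
            (volume.restrict (Ioo 0 t)) := hWm'.mul (mq.const_mul _)
        have m12 : AEMeasurable (fun s ↦ W s * (c₁ * ∑ k, ∑ l, sobolevEnergy i (fun y ↦ fderiv ℝ
            (fun z ↦ fderiv ℝ (w p s) z (stdOrthonormalBasis ℝ E' l)) y (stdOrthonormalBasis ℝ E' k))) +
            W s * (A₂ p * ∑ l, sobolevEnergy i (fun y ↦ fderiv ℝ (w p s) y (stdOrthonormalBasis ℝ E' l))))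
            (volume.restrict (Ioo 0 t)) := m1.add m2
        have m123 : AEMeasurable (fun s ↦ W s * (c₁ * ∑ k, ∑ l, sobolevEnergy i (fun y ↦ fderiv ℝ
            (fun z ↦ fderiv ℝ (w p s) z (stdOrthonormalBasis ℝ E' l)) y (stdOrthonormalBasis ℝ E' k))) +
            W s * (A₂ p * ∑ l, sobolevEnergy i (fun y ↦ fderiv ℝ (w p s) y (stdOrthonormalBasis ℝ E' l))) +
            W s * (A₃ p * ∑ q, (sobolevEnergy i (w q s) +
              ∑ m, sobolevEnergy i (fun y ↦ fderiv ℝ (w q s) y (stdOrthonormalBasis ℝ E' m)))))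
            (volume.restrict (Ioo 0 t)) := m12.add m3
        rw [lintegral_add_left' m123, lintegral_add_left' m12, lintegral_add_left' m1]
        -- each piece (measurability facts in lambda form)
        have mWX : AEMeasurable (fun s ↦ W s * ∑ k, ∑ l, sobolevEnergy i (fun y ↦ fderiv ℝ
            (fun z ↦ fderiv ℝ (w p s) z (stdOrthonormalBasis ℝ E' l)) y (stdOrthonormalBasis ℝ E' k)))
            (volume.restrict (Ioo 0 t)) := hWm'.mul (mX p)
        have mWY : ∀ q, AEMeasurable (fun s ↦ W s * ∑ l, sobolevEnergy i (fun y ↦ fderiv ℝ (w q s) y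
            (stdOrthonormalBasis ℝ E' l))) (volume.restrict (Ioo 0 t)) := fun q ↦ hWm'.mul (mY q)
        have mWZ : ∀ q, AEMeasurable (fun s ↦ W s * sobolevEnergy i (w q s)) (volume.restrict (Ioo 0 t)) :=
          fun q ↦ hWm'.mul (mZ q)
        have mWG : AEMeasurable (fun s ↦ W s * sobolevEnergy i (cutExpr P p (g s))) (volume.restrict (Ioo 0 t)) :=
          hWm'.mul (mG p)
        have e1 : ∫⁻ s in Ioo 0 t, W s * (c₁ * ∑ k, ∑ l, sobolevEnergy i (fun y ↦ fderiv ℝ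
            (fun z ↦ fderiv ℝ (w p s) z (stdOrthonormalBasis ℝ E' l)) y (stdOrthonormalBasis ℝ E' k))) =
            c₁ * X p := by
          calc _ = ∫⁻ s in Ioo 0 t, c₁ * (W s * ∑ k, ∑ l, sobolevEnergy i (fun y ↦ fderiv ℝ
                (fun z ↦ fderiv ℝ (w p s) z (stdOrthonormalBasis ℝ E' l)) y (stdOrthonormalBasis ℝ E' k))) :=
                lintegral_congr fun s ↦ by ring
            _ = c₁ * X p := lintegral_const_mul'' c₁ mWX
        have e2 : ∫⁻ s in Ioo 0 t, W s * (A₂ p * ∑ l, sobolevEnergy i (fun y ↦ fderiv ℝ (w p s) y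
            (stdOrthonormalBasis ℝ E' l))) = A₂ p * Y p := by
          calc _ = ∫⁻ s in Ioo 0 t, A₂ p * (W s * ∑ l, sobolevEnergy i (fun y ↦ fderiv ℝ (w p s) y
              (stdOrthonormalBasis ℝ E' l))) := lintegral_congr fun s ↦ by ring
            _ = A₂ p * Y p := lintegral_const_mul'' (A₂ p) (mWY p)
        have e3 : ∫⁻ s in Ioo 0 t, W s * (A₃ p * ∑ q, (sobolevEnergy i (w q s) +
            ∑ m, sobolevEnergy i (fun y ↦ fderiv ℝ (w q s) y (stdOrthonormalBasis ℝ E' m)))) =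
            A₃ p * ∑ q, (Z q + Y q) := by
          have mqq : ∀ q, AEMeasurable (fun s ↦ W s * sobolevEnergy i (w q s) +
              W s * ∑ m, sobolevEnergy i (fun y ↦ fderiv ℝ (w q s) y (stdOrthonormalBasis ℝ E' m)))
              (volume.restrict (Ioo 0 t)) := fun q ↦ (mWZ q).add (mWY q)
          have mq' : AEMeasurable (fun s ↦ ∑ q, (W s * sobolevEnergy i (w q s) +
              W s * ∑ m, sobolevEnergy i (fun y ↦ fderiv ℝ (w q s) y (stdOrthonormalBasis ℝ E' m))))
              (volume.restrict (Ioo 0 t)) := Finset.aemeasurable_fun_sum _ fun q _ ↦ mqq q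
          calc _ = ∫⁻ s in Ioo 0 t, A₃ p * ∑ q, (W s * sobolevEnergy i (w q s) +
                W s * ∑ m, sobolevEnergy i (fun y ↦ fderiv ℝ (w q s) y (stdOrthonormalBasis ℝ E' m))) := by
                refine lintegral_congr fun s ↦ ?_
                rw [Finset.mul_sum, Finset.mul_sum, Finset.mul_sum]
                refine Finset.sum_congr rfl fun q _ ↦ ?_
                ring
            _ = A₃ p * ∫⁻ s in Ioo 0 t, ∑ q, (W s * sobolevEnergy i (w q s) +
                W s * ∑ m, sobolevEnergy i (fun y ↦ fderiv ℝ (w q s) y (stdOrthonormalBasis ℝ E' m))) :=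
                lintegral_const_mul'' (A₃ p) mq'
            _ = A₃ p * ∑ q, ∫⁻ s in Ioo 0 t, (W s * sobolevEnergy i (w q s) +
                W s * ∑ m, sobolevEnergy i (fun y ↦ fderiv ℝ (w q s) y (stdOrthonormalBasis ℝ E' m))) := by
                rw [lintegral_finsetSum' _ fun q _ ↦ mqq q]
            _ = A₃ p * ∑ q, (Z q + Y q) := by
                congr 1
                refine Finset.sum_congr rfl fun q _ ↦ ?_
                rw [lintegral_add_left' (mWZ q)]
        have e4 : ∫⁻ s in Ioo 0 t, W s * (A₄ p * sobolevEnergy i (cutExpr P p (g s))) = A₄ p * G p := by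
          calc _ = ∫⁻ s in Ioo 0 t, A₄ p * (W s * sobolevEnergy i (cutExpr P p (g s))) :=
                lintegral_congr fun s ↦ by ring
            _ = A₄ p * G p := lintegral_const_mul'' (A₄ p) mWG
        rw [e1, e2, e3, e4]
  -- Step 2: sum over the patches and absorb
  set Rt : ℝ≥0∞ := ∑ p, R p with hRt
  set Gt : ℝ≥0∞ := ∑ p, G p with hGt
  have hRttop : Rt ≠ ⊤ := ENNReal.sum_ne_top.2 fun p _ ↦ hRtop p
  have hYR : ∑ p, Y p ≤ ENNReal.ofReal (lam⁻¹ / 2) * Rt := by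
    rw [hRt, Finset.mul_sum]; exact Finset.sum_le_sum fun p _ ↦ hYle p
  have hZR : ∑ p, Z p ≤ ENNReal.ofReal (lam⁻¹ ^ 2) * Rt := by
    rw [hRt, Finset.mul_sum]; exact Finset.sum_le_sum fun p _ ↦ hZle p
  have hXR : ∑ p, X p ≤ (Module.finrank ℝ E' : ℝ≥0∞) * Rt := by
    rw [hRt, Finset.mul_sum]; exact Finset.sum_le_sum fun p _ ↦ hXle p
  -- smallness of the coefficients
  have hc₁n : c₁ * (Module.finrank ℝ E' : ℝ≥0∞) ≤ 4⁻¹ := by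
    rw [hc₁, ← ENNReal.ofReal_natCast, ← ENNReal.ofReal_mul (by positivity)]
    have h : 4 * (Module.finrank ℝ E' : ℝ) ^ 2 * η ^ 2 * (Module.finrank ℝ E' : ℝ) ≤ 4⁻¹ := by nlinarith
    refine (ENNReal.ofReal_le_ofReal h).trans ?_
    rw [ENNReal.ofReal_inv_of_pos (by norm_num)]
    norm_num
  have hlamc : a₂ * ENNReal.ofReal (lam⁻¹ / 2) + a₃ * (ENNReal.ofReal (lam⁻¹ ^ 2) + ENNReal.ofReal (lam⁻¹ / 2)) ≤
      4⁻¹ := by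
    have hl1 : ENNReal.ofReal (lam⁻¹ / 2) ≤ ENNReal.ofReal lam⁻¹ :=
      ENNReal.ofReal_le_ofReal (by linarith [inv_nonneg.2 hlam0.le])
    have hl2 : ENNReal.ofReal (lam⁻¹ ^ 2) ≤ ENNReal.ofReal lam⁻¹ := by
      refine ENNReal.ofReal_le_ofReal ?_
      have h1 : lam⁻¹ ≤ 1 := inv_le_one_of_one_le₀ hlam1
      nlinarith [inv_nonneg.2 hlam0.le]
    calc a₂ * ENNReal.ofReal (lam⁻¹ / 2) + a₃ * (ENNReal.ofReal (lam⁻¹ ^ 2) + ENNReal.ofReal (lam⁻¹ / 2))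
        ≤ a₂ * ENNReal.ofReal lam⁻¹ + a₃ * (ENNReal.ofReal lam⁻¹ + ENNReal.ofReal lam⁻¹) := by gcongr
      _ = ENNReal.ofReal lam⁻¹ * Kc := by rw [hKc]; ring
      _ = ENNReal.ofReal lam⁻¹ * ENNReal.ofReal Kc.toReal := by rw [ENNReal.ofReal_toReal hKctop]
      _ = ENNReal.ofReal (lam⁻¹ * Kc.toReal) := by rw [ENNReal.ofReal_mul (inv_nonneg.2 hlam0.le)]
      _ ≤ ENNReal.ofReal 4⁻¹ := by
          refine ENNReal.ofReal_le_ofReal ?_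
          rw [inv_mul_le_iff₀ hlam0]
          linarith [ENNReal.toReal_nonneg (a := Kc)]
      _ = 4⁻¹ := by rw [ENNReal.ofReal_inv_of_pos (by norm_num)]; norm_num
  -- the summed inequality
  have hsum : Rt ≤ 2⁻¹ * Rt + a₄ * Gt := by
    calc Rt = ∑ p, R p := hRt
      _ ≤ ∑ p, (c₁ * X p + A₂ p * Y p + A₃ p * ∑ q, (Z q + Y q) + A₄ p * G p) :=
          Finset.sum_le_sum fun p _ ↦ hRle p
      _ = c₁ * ∑ p, X p + ∑ p, A₂ p * Y p + a₃ * ∑ q, (Z q + Y q) + ∑ p, A₄ p * G p := by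
          rw [ha₃]
          simp only [Finset.sum_add_distrib, Finset.mul_sum, Finset.sum_mul]
      _ ≤ c₁ * ((Module.finrank ℝ E' : ℝ≥0∞) * Rt) + a₂ * ∑ p, Y p +
          a₃ * (∑ q, Z q + ∑ q, Y q) + a₄ * Gt := by
          refine add_le_add (add_le_add (add_le_add ?_ ?_) (le_of_eq ?_)) ?_
          · exact mul_le_mul' le_rfl hXR
          · rw [Finset.mul_sum]; exact Finset.sum_le_sum fun p _ ↦ mul_le_mul' (hA₂le p) le_rfl
          · rw [Finset.sum_add_distrib]
          · rw [hGt, Finset.mul_sum]; exact Finset.sum_le_sum fun p _ ↦ mul_le_mul' (hA₄le p) le_rfl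
      _ ≤ c₁ * ((Module.finrank ℝ E' : ℝ≥0∞) * Rt) + a₂ * (ENNReal.ofReal (lam⁻¹ / 2) * Rt) +
          a₃ * (ENNReal.ofReal (lam⁻¹ ^ 2) * Rt + ENNReal.ofReal (lam⁻¹ / 2) * Rt) + a₄ * Gt := by
          gcongr
      _ = (c₁ * (Module.finrank ℝ E' : ℝ≥0∞) + (a₂ * ENNReal.ofReal (lam⁻¹ / 2) +
          a₃ * (ENNReal.ofReal (lam⁻¹ ^ 2) + ENNReal.ofReal (lam⁻¹ / 2)))) * Rt + a₄ * Gt := by ring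
      _ ≤ (4⁻¹ + 4⁻¹) * Rt + a₄ * Gt := by gcongr
      _ = 2⁻¹ * Rt + a₄ * Gt := by
          have hq : (4⁻¹ : ℝ≥0∞) + 4⁻¹ = 2⁻¹ := by
            rw [← ENNReal.ofReal_ofNat 4, ← ENNReal.ofReal_ofNat 2,
              ← ENNReal.ofReal_inv_of_pos (by norm_num), ← ENNReal.ofReal_inv_of_pos (by norm_num),
              ← ENNReal.ofReal_add (by norm_num) (by norm_num)]
            norm_num
          rw [hq]
  have hfin := ENNReal.le_of_le_half_mul_add hRttop hsum
  calc ∑ p, ∫⁻ s in Ioo 0 t, W s * sobolevEnergy i (slabResidual 1 T' (fun s ↦ cutExpr P p (v s)) s)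
      = Rt := by rw [hRt]
    _ ≤ 2 * (a₄ * Gt) := hfin
    _ = 2 * a₄ * ∑ p, ∫⁻ s in Ioo 0 t, W s * sobolevEnergy i (cutExpr P p (g s)) := by rw [hGt, mul_assoc]

end Main

section MaxReg

variable [IsManifold I ∞ M] [I.Boundaryless] [T2Space M] [MeasurableSpace E'] [BorelSpace E'] [FiniteDimensional ℝ F'] {T : ℝ}

/-- **Weighted maximal-regularity a priori estimate, uniform in sub-slabs.** For every
order `i` there are `Λ ≥ 1` and `C < ∞` such that for every `λ ≥ Λ`, every `T' ≤ T`, every solution `v` on `[0, T']`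
(`v(0) = 0`) of the chart form of the linear system with source `g`, and every `t ∈ [0, T]`:
`Σ_p maxRegQ i λ w_p t ≤ C Σ_p ∫₀ᵗ e^{-2λs} E_i(cutExpr P p (g s))` and, for every `p`,
`e^{-2λt} E_i(w_p(t)) ≤ C λ⁻¹ Σ_p ∫₀ᵗ e^{-2λs} E_i(cutExpr P p (g s))`.
[cite: Evans2010, §7.1.3] -/
theorem maxreg_apriori_le_unif (hT : 0 < T) (i : ℕ) {S : ι → ℝ → E' → (E' →L[ℝ] E')}
    {𝔟 : ι → ℝ → E' → ((E' →L[ℝ] F') →L[ℝ] F')} {𝔠 : ι → ℝ → E' → (F' →L[ℝ] F')}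
    (hS : ∀ p, ContDiffOn ℝ ∞ (uncurry (S p)) (Icc 0 T ×ˢ (P.chart p).target))
    (h𝔟 : ∀ p, ContDiffOn ℝ ∞ (uncurry (𝔟 p)) (Icc 0 T ×ˢ (P.chart p).target))
    (h𝔠 : ∀ p, ContDiffOn ℝ ∞ (uncurry (𝔠 p)) (Icc 0 T ×ˢ (P.chart p).target)) {η : ℝ} (hη : 0 ≤ η)
    (hηS : ∀ p, ∀ s ∈ Icc 0 T, ∀ y ∈ closedBall (0 : E') (4 * P.r p), ‖S p s y - 1‖ ≤ η)
    (hsmall : 16 * (Module.finrank ℝ E' : ℝ) ^ 3 * η ^ 2 ≤ 1) :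
    ∃ Λ : ℝ, 1 ≤ Λ ∧ ∃ C : ℝ≥0∞, C ≠ ⊤ ∧ ∀ {lam : ℝ}, Λ ≤ lam → ∀ {T' : ℝ}, 0 < T' → T' ≤ T → ∀ {v g : ℝ → M → F'},
      (∀ p, ContDiffOn ℝ ∞ (uncurry fun s y ↦ v s ((P.chart p).inv y)) (Icc 0 T' ×ˢ (P.chart p).target)) →
      (∀ x, v 0 x = 0) →
      (∀ p, ContDiffOn ℝ ∞ (uncurry fun s y ↦ g s ((P.chart p).inv y)) (Icc 0 T' ×ˢ (P.chart p).target)) →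
      (∀ p, ∀ s ∈ Icc 0 T', ∀ y ∈ (P.chart p).target,
        timeDerivWithin (Icc 0 T') (fun s y ↦ v s ((P.chart p).inv y)) s y =
          frameOp (S p s y) (𝔟 p s y) (𝔠 p s y) (fun y ↦ v s ((P.chart p).inv y)) y + g s ((P.chart p).inv y)) →
      ∀ t ∈ Icc 0 T',
        (∑ p, maxRegQ i lam (fun s ↦ cutExpr P p (v s)) t ≤
          C * ∑ p, ∫⁻ s in Ioo 0 t, ENNReal.ofReal (Real.exp (-2 * lam * s)) * sobolevEnergy i (cutExpr P p (g s))) ∧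
        ∀ p, ENNReal.ofReal (Real.exp (-2 * lam * t)) * sobolevEnergy i (cutExpr P p (v t)) ≤
          C * ENNReal.ofReal lam⁻¹ * ∑ p, ∫⁻ s in Ioo 0 t, ENNReal.ofReal (Real.exp (-2 * lam * s)) * sobolevEnergy i (cutExpr P p (g s)) := by
  classical
  obtain ⟨Λ, hΛ, C, hCtop, hC⟩ := linear_apriori_residual_le_unif P hT i hS h𝔟 h𝔠 hη hηS hsmall
  refine ⟨max Λ 1, le_max_right _ _, ((Module.finrank ℝ E' : ℝ≥0∞) + 2) * C, ENNReal.mul_ne_top (by simp) hCtop, ?_⟩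
  intro lam hlam T' hT' hT'T v g hv hv0 hg hchart t ht
  have hlamΛ : Λ ≤ lam := (le_max_left _ _).trans hlam
  have hlam1 : 1 ≤ lam := (le_max_right _ _).trans hlam
  have hlam0 : 0 < lam := by linarith
  have hap := hC hlamΛ hT' hT'T hv hv0 hg hchart t ht
  set G := ∑ p, ∫⁻ s in Ioo 0 t, ENNReal.ofReal (Real.exp (-2 * lam * s)) * sobolevEnergy i (cutExpr P p (g s)) with hG
  have hw : ∀ p, IsSmoothSpaceTimeOn (Icc 0 T') fun s ↦ cutExpr P p (v s) := fun p ↦ isSmoothSpaceTimeOn_cutExpr P p (hv p)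
  refine ⟨?_, fun p ↦ ?_⟩
  · calc ∑ p, maxRegQ i lam (fun s ↦ cutExpr P p (v s)) t
        ≤ ∑ p, ((Module.finrank ℝ E' : ℝ≥0∞) + 2) *
            ∫⁻ s in Ioo 0 t, ENNReal.ofReal (Real.exp (-2 * lam * s)) * sobolevEnergy i (slabResidual 1 T' (fun s ↦ cutExpr P p (v s)) s) :=
          Finset.sum_le_sum fun p _ ↦ maxRegQ_le_residual hT' (hw p) (isCompact_closedBall (0 : E') (3 * P.r p))
            (fun s y hy ↦ cutExpr_family_eq_zero P p s hy) (cutExpr_family_zero P p hv0) hlam1 i ht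
      _ = ((Module.finrank ℝ E' : ℝ≥0∞) + 2) *
            ∑ p, ∫⁻ s in Ioo 0 t, ENNReal.ofReal (Real.exp (-2 * lam * s)) * sobolevEnergy i (slabResidual 1 T' (fun s ↦ cutExpr P p (v s)) s) := by
          rw [Finset.mul_sum]
      _ ≤ ((Module.finrank ℝ E' : ℝ≥0∞) + 2) * (C * G) := mul_le_mul' le_rfl hap
      _ = _ := by rw [mul_assoc]
  · have hpt := weight_mul_sobolevEnergy_le_residual (ν := (1 : ℝ)) hT' one_pos (hw p) (isCompact_closedBall (0 : E') (3 * P.r p))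
      (fun s y hy ↦ cutExpr_family_eq_zero P p s hy) (cutExpr_family_zero P p hv0) hlam0 i ht
    calc ENNReal.ofReal (Real.exp (-2 * lam * t)) * sobolevEnergy i (cutExpr P p (v t))
        ≤ ENNReal.ofReal lam⁻¹ * ∫⁻ s in Ioo 0 t, ENNReal.ofReal (Real.exp (-2 * lam * s)) *
            sobolevEnergy i (slabResidual 1 T' (fun s ↦ cutExpr P p (v s)) s) := hpt
      _ ≤ ENNReal.ofReal lam⁻¹ * ∑ q, ∫⁻ s in Ioo 0 t, ENNReal.ofReal (Real.exp (-2 * lam * s)) *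
            sobolevEnergy i (slabResidual 1 T' (fun s ↦ cutExpr P q (v s)) s) :=
          mul_le_mul' le_rfl (Finset.single_le_sum (f := fun q ↦ ∫⁻ s in Ioo 0 t, ENNReal.ofReal (Real.exp (-2 * lam * s)) *
            sobolevEnergy i (slabResidual 1 T' (fun s ↦ cutExpr P q (v s)) s)) (fun _ _ ↦ bot_le) (Finset.mem_univ p))
      _ ≤ ENNReal.ofReal lam⁻¹ * (C * G) := mul_le_mul' le_rfl hap
      _ ≤ ((Module.finrank ℝ E' : ℝ≥0∞) + 2) * C * ENNReal.ofReal lam⁻¹ * G := by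
          rw [show ENNReal.ofReal lam⁻¹ * (C * G) = 1 * C * ENNReal.ofReal lam⁻¹ * G by ring]
          gcongr
          exact le_add_left (by norm_num)

end MaxReg

end PatchSystemLoc

end Literature.Analysis.PDE
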